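import Literature.MathematicalPhysics.QuantumFieldTheory.Balaban1983to89.Node00.Record12MeasurabilityAtRecord
import Literature.MathematicalPhysics.QuantumFieldTheory.Balaban1983to89.Node00.Record12MeasurabilityAnySelector
import Literature.MathematicalPhysics.QuantumFieldTheory.Balaban1983to89.Node00.Record12LiveSelectorTorus

/-!
# NODE 00 — K0′ COMPONENTS G3, FILE 6: rows P1 `intPiece`, P2 `measω`, P3 `measChi` AT THE LIVE RE-PIN `θ₀ˡⁱᵛᵉ = theta12LiveOfRecord F N (zeta316OfRecord …) Rz Zt`
# (director-ym LINE №114 (α)); `Provisos₁₀` ∕ `Provisos₁₂` ∕ K0′'s body THERE from exactly the four named rows (H-U), P6, P7, P11 — row P12 no longer a hypothesis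

Cell `pub-ymgap`, NODE 00, prover seat `pub-ymgap-node00-def-K0c` (g3); K0′ = `stmt-QuantumFields-19902` `Record12Inhabited` (rev 15; 12b v2.3).
[III] = [Balaban1988Convergent], [IV] = [Balaban1989LargeFieldI].

WHY.  FILE 3 (`Node00/Record12MeasurabilityAtRecord`, p466926 ∕ p467255 ∕ p467481) keys the three rows and the `Provisos₁₀ ∕ Provisos₁₂ ∕ K0′-body` assembly at
`θ₀ = theta12OfRecord …`, and its generic form `Stage12Params.provisos₁₀_of_localBg_of_residuals` carries `hsel : θ.ppSel = ppSelIdOfRecord …` — the IDENTITY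
selector, read by row P1 `intPiece` only.  Director-ym LINE №114 (α) RE-PINNED the K0′ witness to seat K0a's LIVE selector: `θ₀ˡⁱᵛᵉ = theta12LiveOfRecord F N ζ Rz Zt
= (theta12OfRecord F N ζ Rz Zt).liveRepin` (`Node00/Record12LiveSelector`, p477230 ∕ p478753), at which 12b's `SlotsNondegenerate` is a THEOREM from `Provisos₁₀`
alone (`Node00/Record12LiveSelectorTorus` v1.1, p479166: `Stage12Params.slotsNondegenerate_liveRepin`) and K0′'s body for `F` follows from `Provisos₁₂ θ₀ˡⁱᵛᵉ` ALONE
(`exists_k0prime_of_theta12Live_of_provisos₁₂`).  Of `Provisos₁₂` only `.base` reads the selector (K0a), and of `.base` only `intPiece` and `rstep`.  This file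
re-keys the G3 rows at the live re-pin and SPLITS `Provisos₁₂ θ₀ˡⁱᵛᵉ` into its rows.

WHAT THIS FILE PROVES (theorems only; by-name knit of FILE 1 ∕ 2 ∕ 3, K0a, K0b).
* §1 ANY SELECTOR (generic `θ : Stage12Params` carrying K0b's residuals of record `HasResidualsOfRecord`): `Stage12Params.provisos₁₀_of_localBg_anySel` — FILE 3's
  theorem WITHOUT `hsel` (row P1 by FILE 2's `Stage9Params.intPiece_of_localBg_anySel`; its sign law `0 ≤ ζ` is K0b's `zeta316OfRecord_nonneg`), `…provisos₁₂_of_localBg_anySel`,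
  `…record12Inhabited_body15_of_anySel` (row P12 still a hypothesis at a general selector).
* §2 AT THE LIVE RE-PIN `θ.liveRepin` of ANY `θ`: `Stage12Params.provisos₁₀_liveRepin_of_localBg (hU hres hrstep hcontT)`, `…provisos₁₂_liveRepin_of_localBg (… hbg)`,
  the selector-blindness of the row-P11 run objects (`settingOfRecord₁₂_liveRepin`, `suppOfRecord₁₂_liveRepin`, `UbgOfRecord₁₂_liveRepin`, `bg_liveRepin_iff`), and
  **`Stage12Params.record12Inhabited_body15_liveRepin_of (hU hres hrstep hcontT hbg hadm)`** — K0′'s rev-15 body with NO `SlotsNondegenerate` hypothesis (K0a's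
  `slotsNondegenerate_liveRepin` BY NAME at the `Provisos₁₀` just assembled).
* §3 AT θ₀ˡⁱᵛᵉ OF RECORD: **`measChi_theta12LiveOfRecord`**, **`measω_theta12LiveOfRecord`**, **`intPiece_theta12LiveOfRecord`** — rows P3 ∕ P2 ∕ P1 VERBATIM as
  `Provisos₁₀` displays them at `θ₀ˡⁱᵛᵉ.toStage9Params` (up to the `rfl` views `ν = numerics7OfRecord₁₂`, `τ9.M = 1`, `A₁ = 1`), every `Rz`, `Zt`, from the SINGLE hypothesis
  `hU : LocalBgMeasurable F N numerics7OfRecord₁₂`; `provisos₁₀_theta12LiveOfRecord_of_localBg (hU hrstep hcontT)` (= the ONE hypothesis of K0a's rung-A landing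
  `Base12 ⟸ Provisos₁₀ θ₀ˡⁱᵛᵉ`, plan ANSWER №122, from three named rows); `provisos₁₂_theta12LiveOfRecord_of_localBg (hU hrstep hcontT hbg)`; `bg_theta12LiveOfRecord_iff`
  (row P11 at θ₀ˡⁱᵛᵉ IS row P11 at θ₀: FILE 3's `hbg` text); ★ **`record12Inhabited_body15_theta12LiveOfRecord_of (hU hrstep hcontT hbg)`** (every `N`) and
  **`exists_k0prime_of_localBg_theta12Live F (hU hrstep hcontT hbg)`** (the text of 19902 for `F`, `N = 2`): K0′'s body from EXACTLY FOUR NAMED ROWS read at θ₀ˡⁱᵛᵉ —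
  (H-U) `LocalBgMeasurable F N numerics7OfRecord₁₂` · P6 `rstep` (support form, at the live selector's slot families) · P7 `contT` (selector-blind) · P11 `bg`
  (selector-blind) — rows P1 ∕ P2 ∕ P3 ∕ P4 ∕ P5 ∕ (H-ζ) ∕ P12 ∕ `ZtUnity` ∕ `Admissible` ∕ `rzLaws` ∕ `ztLaws` ∕ `ztLocal` being THEOREMS there.
* §4 the same at `N = 2` in the shape of plan g65's skeleton v4-LIVE: `provisos₁₂_theta12LiveOfRecord_of_base (hbase hbg)` (= `stub_resid12Live` MODULO ROW P11 ONLY: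
  rung B's residual laws are K0b's theorems) and `exists_k0prime_of_base_of_bg_theta12Live F (hbase hbg)` (K0′(F) ⟸ rung A ∧ P11).
NET.  K0a: K0′(F) ⟸ `Provisos₁₂ θ₀ˡⁱᵛᵉ`; this file: `Provisos₁₂ θ₀ˡⁱᵛᵉ` ⟸ (H-U) ∧ P6 ∧ P7 ∧ P11.  Row P6 in def-R's INTEGRABLE form at θ₀ˡⁱᵛᵉ from (H-U) alone is
seat def-R's FILE 18 (`Node00/RStepProvisosIntAtRecord`: `Stage12Params.rstepInt_liveRepin_of_localBg`, `rstepInt_theta12LiveOfRecord`) — NOT declared here (one declarer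
per name); (H-U) is a theorem for the re-pointed datum `bgSelOfRecord` (FILE 5 `Node00/Record12MinimiserSelection.measurable_ukBox_bgSel`, p477848) and LOCATED-OPEN by design
for the current `UminOfRecord`; P7 on-domain = K0e; P11 = the estimate of print.

HONEST FRAMING — what this is NOT.  Instantiation by name; (H-U), P6, P7, P11 are DISPLAYED HYPOTHESES, neither asserted nor discharged; nothing of Bałaban's is
asserted; no field of `Provisos₁₂` is inhabited absolutely at `N ≥ 2`; K0′ is NOT discharged; no node count moves (typed 28∕28 · discharged 5∕28).  One finite
four-torus programme at fixed `ε = L^{−K}` — NOT the continuum limit on ℝ⁴, NOT infinite volume, NOT OS, NOT a mass gap, NOT the Clay problem.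
No `sorry`, no `axiom`, no `def`, no `instance`, no `notation`.
-/

noncomputable section

open MeasureTheory
open scoped Matrix.Norms.L2Operator

namespace Literature.MathematicalPhysics.QuantumFieldTheory.Balaban1983to89.Node00

open T4Continuum B14.Eq218Concrete T4AveragingDisintegration T4FiniteEpsInhabited B14.Sect3Decomp B15RopTotal

variable (F : T4Family) (N : ℕ) [NeZero N]

/-! ## §1. ANY SELECTOR: `Provisos₁₀` ∕ `Provisos₁₂` ∕ K0′'s body at a Stage-12 parameter with K0b's residuals of record, no hypothesis on `θ.ppSel` -/

section AnySelector

variable {F N}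

/-- **`base = Provisos₁₀` AT A STAGE-12 PARAMETER WITH THE RESIDUALS OF RECORD AND AN ARBITRARY SELECTOR, MODULO ROWS (H-U), P6, P7** — FILE 3's
`Stage12Params.provisos₁₀_of_localBg_of_residuals` WITHOUT its identity-selector hypothesis `hsel`: row P1 `intPiece` by FILE 2's any-selector theorem
`Stage9Params.intPiece_of_localBg_anySel` (the fibre mechanism of (0.4) needs the sign law `0 ≤ ζ`, which K0b's (3.16) factor of record has: `zeta316OfRecord_nonneg`), rows
P2 ∕ P3 by FILE 1 ((H-ζ) by FILE 3's `zetaMeasurable_zeta316OfRecord_of_localBg`), P4 ∕ P5 by K0b; `rstep` (row P6, support form, def-R) and `contT` (row P7, K0e) are HYPOTHESES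
displayed verbatim (they read `θ.ppSel` as it is). [cite: Balaban1988Convergent, (2.18) p.257, (3.2)–(3.9) pp.265–266, (3.16) p.268; Balaban1989LargeFieldI, (0.3)–(0.4) p.176 (bookkeeping)] -/
theorem Stage12Params.provisos₁₀_of_localBg_anySel (θ : Stage12Params F N)
    (hU : LocalBgMeasurable F N θ.ν) (hres : θ.HasResidualsOfRecord F N)
    (hrstep : ∀ (p : B12.RunParams) (k : ℕ) [DecidableEq (PBond (F.P p.K) (k + 1))], k < p.K →
      (towerRepOfRecord F N θ.ν θ.τ9 (slotsTOfRecord F N θ.ν θ.τ9 (EOfRecord₁₀ F N θ.toStage9Params) (wOfRecord₉ F N θ.toStage9Params) θ.ppSel)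
        θ.ppSel p (gOfRecord₁₀ F N θ.toStage9Params p) (k + 1)).toRepData.ProvisosSupp)
    (hcontT : θ.toStage8Params.HasContTransportAlong) : θ.toStage9Params.Provisos₁₀ where
  intPiece := θ.toStage9Params.intPiece_of_localBg_anySel hU
    (by rw [hres.zeta_eq]; exact zetaMeasurable_zeta316OfRecord_of_localBg hU θ.τ9.M θ.A₁) hres.zetaAbs
    (by rw [hres.zeta_eq]; exact fun p g k s Pl Ql RS U V' => zeta316OfRecord_nonneg θ.A₁ p g k s Pl Ql RS U V')
  measω := θ.toStage9Params.measω_of_localBg hU (by rw [hres.zeta_eq]; exact zetaMeasurable_zeta316OfRecord_of_localBg hU θ.τ9.M θ.A₁)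
  measChi := θ.toStage9Params.measChi_of_localBg hU
  zetaUnity := hres.zetaUnity
  zetaAbs := hres.zetaAbs
  rstep := fun p k _ hk => hrstep p k hk
  contT := hcontT

/-- **`Provisos₁₂` AT SUCH A PARAMETER (any selector), MODULO ROWS (H-U), P6, P7, P11**: `base` as above; `rzLaws`, `ztLaws`, `ztLocal` are K0b's; `bg` (row P11,
the window-guarded estimate of print) is a HYPOTHESIS, displayed verbatim. [cite: Balaban1988Convergent, (2.28) p.259, (2.35) p.261; Balaban1987RG1, (1.15) p.262 (bookkeeping)] -/
theorem Stage12Params.provisos₁₂_of_localBg_anySel (θ : Stage12Params F N)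
    (hU : LocalBgMeasurable F N θ.ν) (hres : θ.HasResidualsOfRecord F N)
    (hrstep : ∀ (p : B12.RunParams) (k : ℕ) [DecidableEq (PBond (F.P p.K) (k + 1))], k < p.K →
      (towerRepOfRecord F N θ.ν θ.τ9 (slotsTOfRecord F N θ.ν θ.τ9 (EOfRecord₁₀ F N θ.toStage9Params) (wOfRecord₉ F N θ.toStage9Params) θ.ppSel)
        θ.ppSel p (gOfRecord₁₀ F N θ.toStage9Params p) (k + 1)).toRepData.ProvisosSupp)
    (hcontT : θ.toStage8Params.HasContTransportAlong)
    (hbg : ∀ (p : B12.RunParams) (n : ℕ), n ≤ p.K → Step.InInterval θ.γ n (gOfRecord₁₀ F N θ.toStage9Params p) →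
      BgProviso F N p.K (settingOfRecord₁₂ F N θ p) (θ.Rz p.K) θ.τ9.M n (suppOfRecord₁₂ F N θ p n) (UbgOfRecord₁₂ F N θ p n)) :
    θ.Provisos₁₂ F N :=
  ⟨θ.provisos₁₀_of_localBg_anySel hU hres hrstep hcontT, hres.rzLaws, hres.ztLaws, hres.ztLocal, hbg⟩

/-- **K0′'s rev-15 BODY for the family `F` (every `N`), any selector, MODULO ROWS (H-U), P6, P7, P11, P12**: `∃ θ, Provisos₁₂ ∧ (ZtUnity ∧ SlotsNondegenerate) ∧
Admissible` at any admissible Stage-12 parameter with K0b's residuals; `SlotsNondegenerate` (row P12) is a HYPOTHESIS here (at the LIVE re-pin it is a theorem, §2).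
A REDUCTION — nothing is discharged. [cite: Balaban1988Convergent, Thm 1 p.262; Balaban1989LargeFieldII, Thm 1 p.355 (bookkeeping)] -/
theorem Stage12Params.record12Inhabited_body15_of_anySel (θ : Stage12Params F N)
    (hU : LocalBgMeasurable F N θ.ν) (hres : θ.HasResidualsOfRecord F N)
    (hrstep : ∀ (p : B12.RunParams) (k : ℕ) [DecidableEq (PBond (F.P p.K) (k + 1))], k < p.K →
      (towerRepOfRecord F N θ.ν θ.τ9 (slotsTOfRecord F N θ.ν θ.τ9 (EOfRecord₁₀ F N θ.toStage9Params) (wOfRecord₉ F N θ.toStage9Params) θ.ppSel)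
        θ.ppSel p (gOfRecord₁₀ F N θ.toStage9Params p) (k + 1)).toRepData.ProvisosSupp)
    (hcontT : θ.toStage8Params.HasContTransportAlong)
    (hbg : ∀ (p : B12.RunParams) (n : ℕ), n ≤ p.K → Step.InInterval θ.γ n (gOfRecord₁₀ F N θ.toStage9Params p) →
      BgProviso F N p.K (settingOfRecord₁₂ F N θ p) (θ.Rz p.K) θ.τ9.M n (suppOfRecord₁₂ F N θ p n) (UbgOfRecord₁₂ F N θ p n))
    (hnd : θ.SlotsNondegenerate) (hadm : θ.Admissible F N) :
    ∃ θ' : Stage12Params F N, θ'.Provisos₁₂ F N ∧ (θ'.ZtUnity F N ∧ θ'.SlotsNondegenerate) ∧ θ'.Admissible F N :=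
  ⟨θ, θ.provisos₁₂_of_localBg_anySel hU hres hrstep hcontT hbg, ⟨hres.ztUnity, hnd⟩, hadm⟩

end AnySelector

/-! ## §2. AT THE LIVE RE-PIN `θ.liveRepin` (seat K0a, director-ym №114 (α)): `Provisos₁₀` ∕ `Provisos₁₂` modulo (H-U), P6 (support form, at the live selector's
families), P7, P11; K0′'s body WITHOUT a row-P12 hypothesis -/

section LiveRepin

variable {F N} (θ : Stage12Params F N)

/-- **`Provisos₁₀` AT THE LIVE RE-PIN, MODULO (H-U), P6, P7** (§1 at `θ.liveRepin`; the residuals, numerics, histories, normalisations and step weights are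
selector-blind — K0a's `rfl` views and `HasResidualsOfRecord.liveRepin`). [cite: Balaban1988Convergent, (2.18) p.257, (3.2)–(3.9) pp.265–266; Balaban1989LargeFieldI, (0.3)–(0.4) p.176 (bookkeeping)] -/
theorem Stage12Params.provisos₁₀_liveRepin_of_localBg (hU : LocalBgMeasurable F N θ.ν) (hres : θ.HasResidualsOfRecord F N)
    (hrstep : ∀ (p : B12.RunParams) (k : ℕ) [DecidableEq (PBond (F.P p.K) (k + 1))], k < p.K →
      (towerRepOfRecord F N θ.ν θ.τ9
        (slotsTOfRecord F N θ.ν θ.τ9 (EOfRecord₁₀ F N θ.toStage9Params) (wOfRecord₉ F N θ.toStage9Params) (θ.liveRepin F N).ppSel)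
        (θ.liveRepin F N).ppSel p (gOfRecord₁₀ F N θ.toStage9Params p) (k + 1)).toRepData.ProvisosSupp)
    (hcontT : θ.toStage8Params.HasContTransportAlong) : (θ.liveRepin F N).toStage9Params.Provisos₁₀ :=
  (θ.liveRepin F N).provisos₁₀_of_localBg_anySel hU hres.liveRepin hrstep hcontT

/-- **`Provisos₁₂` AT THE LIVE RE-PIN, MODULO (H-U), P6, P7, P11** — `bg` displayed at the re-pin verbatim (its run objects `settingOfRecord₁₂`, `suppOfRecord₁₂`,
`UbgOfRecord₁₂`, `Rz` read no selector: `bg_liveRepin_iff` below). [cite: Balaban1988Convergent, (2.28) p.259, (2.35) p.261; Balaban1987RG1, (1.15) p.262 (bookkeeping)] -/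
theorem Stage12Params.provisos₁₂_liveRepin_of_localBg (hU : LocalBgMeasurable F N θ.ν) (hres : θ.HasResidualsOfRecord F N)
    (hrstep : ∀ (p : B12.RunParams) (k : ℕ) [DecidableEq (PBond (F.P p.K) (k + 1))], k < p.K →
      (towerRepOfRecord F N θ.ν θ.τ9
        (slotsTOfRecord F N θ.ν θ.τ9 (EOfRecord₁₀ F N θ.toStage9Params) (wOfRecord₉ F N θ.toStage9Params) (θ.liveRepin F N).ppSel)
        (θ.liveRepin F N).ppSel p (gOfRecord₁₀ F N θ.toStage9Params p) (k + 1)).toRepData.ProvisosSupp)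
    (hcontT : θ.toStage8Params.HasContTransportAlong)
    (hbg : ∀ (p : B12.RunParams) (n : ℕ), n ≤ p.K → Step.InInterval θ.γ n (gOfRecord₁₀ F N θ.toStage9Params p) →
      BgProviso F N p.K (settingOfRecord₁₂ F N (θ.liveRepin F N) p) (θ.Rz p.K) θ.τ9.M n (suppOfRecord₁₂ F N (θ.liveRepin F N) p n)
        (UbgOfRecord₁₂ F N (θ.liveRepin F N) p n)) :
    (θ.liveRepin F N).Provisos₁₂ F N :=
  (θ.liveRepin F N).provisos₁₂_of_localBg_anySel hU hres.liveRepin hrstep hcontT hbg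

/-- **★ K0′'s rev-15 BODY for the family `F` (every `N`) AT THE LIVE RE-PIN, MODULO ROWS (H-U), P6, P7, P11 — NO ROW-P12 HYPOTHESIS**: `SlotsNondegenerate` at
`θ.liveRepin` is K0a's `Stage12Params.slotsNondegenerate_liveRepin` at the `Provisos₁₀` just assembled (12b v2.3: the conjunct is guarded by the torus); `ZtUnity` is
K0b's; `Admissible` is selector-blind.  A REDUCTION — nothing is discharged. [cite: Balaban1988Convergent, Thm 1 p.262, (3.22) p.269; Balaban1989LargeFieldII, Thm 1 p.355 (bookkeeping)] -/
theorem Stage12Params.record12Inhabited_body15_liveRepin_of (hU : LocalBgMeasurable F N θ.ν) (hres : θ.HasResidualsOfRecord F N)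
    (hrstep : ∀ (p : B12.RunParams) (k : ℕ) [DecidableEq (PBond (F.P p.K) (k + 1))], k < p.K →
      (towerRepOfRecord F N θ.ν θ.τ9
        (slotsTOfRecord F N θ.ν θ.τ9 (EOfRecord₁₀ F N θ.toStage9Params) (wOfRecord₉ F N θ.toStage9Params) (θ.liveRepin F N).ppSel)
        (θ.liveRepin F N).ppSel p (gOfRecord₁₀ F N θ.toStage9Params p) (k + 1)).toRepData.ProvisosSupp)
    (hcontT : θ.toStage8Params.HasContTransportAlong)
    (hbg : ∀ (p : B12.RunParams) (n : ℕ), n ≤ p.K → Step.InInterval θ.γ n (gOfRecord₁₀ F N θ.toStage9Params p) →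
      BgProviso F N p.K (settingOfRecord₁₂ F N (θ.liveRepin F N) p) (θ.Rz p.K) θ.τ9.M n (suppOfRecord₁₂ F N (θ.liveRepin F N) p n)
        (UbgOfRecord₁₂ F N (θ.liveRepin F N) p n))
    (hadm : θ.Admissible F N) :
    ∃ θ' : Stage12Params F N, θ'.Provisos₁₂ F N ∧ (θ'.ZtUnity F N ∧ θ'.SlotsNondegenerate) ∧ θ'.Admissible F N :=
  ⟨θ.liveRepin F N, θ.provisos₁₂_liveRepin_of_localBg hU hres hrstep hcontT hbg,
    ⟨hres.liveRepin.ztUnity, Stage12Params.slotsNondegenerate_liveRepin F N θ (θ.provisos₁₀_liveRepin_of_localBg hU hres hrstep hcontT)⟩,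
    hadm.liveRepin⟩

/-- The §2 setting of record reads no selector (`rfl`). [cite: Balaban1988Convergent, (2.28) p.259 (bookkeeping)] -/
theorem Stage12Params.settingOfRecord₁₂_liveRepin (p : B12.RunParams) :
    settingOfRecord₁₂ F N (θ.liveRepin F N) p = settingOfRecord₁₂ F N θ p := rfl

/-- The regular supports of record read no selector (`rfl`). [cite: Balaban1988Convergent, (2.12) p.256 (bookkeeping)] -/
theorem Stage12Params.suppOfRecord₁₂_liveRepin (p : B12.RunParams) :
    suppOfRecord₁₂ F N (θ.liveRepin F N) p = suppOfRecord₁₂ F N θ p := rfl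

/-- The backgrounds of record read no selector. [cite: Balaban1988Convergent, (2.12)–(2.16) pp.256–257 (bookkeeping)] -/
theorem Stage12Params.UbgOfRecord₁₂_liveRepin (p : B12.RunParams) (n : ℕ) :
    UbgOfRecord₁₂ F N (θ.liveRepin F N) p n = UbgOfRecord₁₂ F N θ p n := by
  cases n <;> rfl

/-- **Row P11 `bg` at the live re-pin IS row P11 at `θ`** (the run objects read no selector). [cite: Balaban1988Convergent, (2.28) p.259, (2.35) p.261 (bookkeeping)] -/
theorem Stage12Params.bg_liveRepin_iff :
    (∀ (p : B12.RunParams) (n : ℕ), n ≤ p.K → Step.InInterval θ.γ n (gOfRecord₁₀ F N θ.toStage9Params p) →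
      BgProviso F N p.K (settingOfRecord₁₂ F N (θ.liveRepin F N) p) (θ.Rz p.K) θ.τ9.M n (suppOfRecord₁₂ F N (θ.liveRepin F N) p n)
        (UbgOfRecord₁₂ F N (θ.liveRepin F N) p n)) ↔
    (∀ (p : B12.RunParams) (n : ℕ), n ≤ p.K → Step.InInterval θ.γ n (gOfRecord₁₀ F N θ.toStage9Params p) →
      BgProviso F N p.K (settingOfRecord₁₂ F N θ p) (θ.Rz p.K) θ.τ9.M n (suppOfRecord₁₂ F N θ p n) (UbgOfRecord₁₂ F N θ p n)) := by
  refine forall_congr' fun p => forall_congr' fun n => ?_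
  rw [θ.UbgOfRecord₁₂_liveRepin p n]
  rfl

end LiveRepin

/-! ## §3. AT THE RE-PINNED PARAMETER OF RECORD `θ₀ˡⁱᵛᵉ = theta12LiveOfRecord F N (zeta316OfRecord F N numerics7OfRecord₁₂ 1 1) Rz Zt` -/

section AtLiveRecord

variable {F N} (hU : LocalBgMeasurable F N numerics7OfRecord₁₂)
include hU

/-- **ROW P3 AT θ₀ˡⁱᵛᵉ** (any `ζ`, `Rz`, `Zt`): the front factors `χ_{k+1}(s′)` along the histories of record are measurable, `k < K` — `base.measChi` at `θ₀ˡⁱᵛᵉ` from `hU`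
alone (the row reads no selector). [cite: Balaban1988Convergent, (2.17)–(2.18) p.257, (3.2) p.265 (bookkeeping)] -/
theorem measChi_theta12LiveOfRecord (ζ : ZetaOfRecord F N numerics7OfRecord₁₂ 1) (Rz : (K : ℕ) → Sect2.Residual (F.P K) (MatA N))
    (Zt : (K : ℕ) → TkResidualW F N (FluctV N) K) :
    ∀ (p : B12.RunParams) (k : ℕ), k < p.K →
      ∀ s' : SeqOfRecord F numerics7OfRecord₁₂ 1 (gOfRecord₁₀ F N (theta12LiveOfRecord F N ζ Rz Zt).toStage9Params p) p.K (k + 1),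
        Measurable (chiSeqOfRecord F N numerics7OfRecord₁₂ 1 (gOfRecord₁₀ F N (theta12LiveOfRecord F N ζ Rz Zt).toStage9Params p) p.K (k + 1) s') :=
  (theta12LiveOfRecord F N ζ Rz Zt).toStage9Params.measChi_of_localBg hU

/-- **ROW P2 AT θ₀ˡⁱᵛᵉ** (any `Rz`, `Zt`): the label weights `ω = a·b·ζ` of record at `A₁ = 1` and K0b's `ζ` are jointly measurable in `(V′, U)`, `k < K` — `base.measω` at
`θ₀ˡⁱᵛᵉ` from `hU` alone (the row reads no selector). [cite: Balaban1988Convergent, (3.2)–(3.5) p.265, (3.16) p.268, (3.24)–(3.25) p.270 (bookkeeping)] -/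
theorem measω_theta12LiveOfRecord (Rz : (K : ℕ) → Sect2.Residual (F.P K) (MatA N)) (Zt : (K : ℕ) → TkResidualW F N (FluctV N) K) :
    ∀ (p : B12.RunParams) (k : ℕ), k < p.K →
      ∀ (s : SeqOfRecord F numerics7OfRecord₁₂ 1
          (gOfRecord₁₀ F N (theta12LiveOfRecord F N (zeta316OfRecord F N numerics7OfRecord₁₂ 1 1) Rz Zt).toStage9Params p) p.K k)
        (t : LbOfRecord F numerics7OfRecord₁₂ p
          (gOfRecord₁₀ F N (theta12LiveOfRecord F N (zeta316OfRecord F N numerics7OfRecord₁₂ 1 1) Rz Zt).toStage9Params p) k),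
        Measurable (fun z : GaugeField (F.P p.K) (k + 1) (SU N) × GaugeField (F.P p.K) k (SU N) =>
          ωOfRecord F N numerics7OfRecord₁₂ 1 p
            (gOfRecord₁₀ F N (theta12LiveOfRecord F N (zeta316OfRecord F N numerics7OfRecord₁₂ 1 1) Rz Zt).toStage9Params p) k 1
            (zeta316OfRecord F N numerics7OfRecord₁₂ 1 1) s t z.2 z.1) :=
  (theta12LiveOfRecord F N (zeta316OfRecord F N numerics7OfRecord₁₂ 1 1) Rz Zt).toStage9Params.measω_of_localBg hU
    (zetaMeasurable_zeta316OfRecord_of_localBg hU 1 1)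

/-- **ROW P1 AT θ₀ˡⁱᵛᵉ** (any `Rz`, `Zt`): the level-`k` pieces `χ_k(s)·slot_k(s)` of `ρ_k` of record AT THE LIVE SELECTOR's slot families are integrable, `k < K` —
`base.intPiece` at `θ₀ˡⁱᵛᵉ` from `hU` alone (FILE 2's any-selector theorem; K0b's `isZetaAbsLeOne_zeta316OfRecord` and `zeta316OfRecord_nonneg`; NO bound on the marginal
density of the averaging transport). [cite: Balaban1988Convergent, (2.18) p.257, (3.24)–(3.25) p.270; Balaban1989LargeFieldI, (0.3)–(0.4) p.176 (bookkeeping)] -/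
theorem intPiece_theta12LiveOfRecord (Rz : (K : ℕ) → Sect2.Residual (F.P K) (MatA N)) (Zt : (K : ℕ) → TkResidualW F N (FluctV N) K) :
    ∀ (p : B12.RunParams) (k : ℕ), k < p.K →
      ∀ s : SeqOfRecord F numerics7OfRecord₁₂ 1
          (gOfRecord₁₀ F N (theta12LiveOfRecord F N (zeta316OfRecord F N numerics7OfRecord₁₂ 1 1) Rz Zt).toStage9Params p) p.K k,
        Integrable (fun U =>
          chiSeqOfRecord F N numerics7OfRecord₁₂ 1
              (gOfRecord₁₀ F N (theta12LiveOfRecord F N (zeta316OfRecord F N numerics7OfRecord₁₂ 1 1) Rz Zt).toStage9Params p) p.K k s U *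
            slotsOfRecord F N numerics7OfRecord₁₂ (theta12LiveOfRecord F N (zeta316OfRecord F N numerics7OfRecord₁₂ 1 1) Rz Zt).τ9
              (EOfRecord₁₀ F N (theta12LiveOfRecord F N (zeta316OfRecord F N numerics7OfRecord₁₂ 1 1) Rz Zt).toStage9Params)
              (wOfRecord₉ F N (theta12LiveOfRecord F N (zeta316OfRecord F N numerics7OfRecord₁₂ 1 1) Rz Zt).toStage9Params)
              (theta12LiveOfRecord F N (zeta316OfRecord F N numerics7OfRecord₁₂ 1 1) Rz Zt).ppSel p
              (gOfRecord₁₀ F N (theta12LiveOfRecord F N (zeta316OfRecord F N numerics7OfRecord₁₂ 1 1) Rz Zt).toStage9Params p) k s U)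
          (fieldMeasure (F.P p.K) k (SU N)) :=
  (theta12LiveOfRecord F N (zeta316OfRecord F N numerics7OfRecord₁₂ 1 1) Rz Zt).toStage9Params.intPiece_of_localBg_anySel hU
    (zetaMeasurable_zeta316OfRecord_of_localBg hU 1 1) (isZetaAbsLeOne_zeta316OfRecord 1)
    (fun p g k s Pl Ql RS U V' => zeta316OfRecord_nonneg 1 p g k s Pl Ql RS U V')

/-- **`base = Provisos₁₀` AT θ₀ˡⁱᵛᵉ OF RECORD, MODULO (H-U), P6, P7** — the ONE hypothesis of K0a's rung-A landing `Base12 ⟸ Provisos₁₀ θ₀ˡⁱᵛᵉ` (plan ANSWER №122), from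
three named rows: rows P1–P5 and (H-ζ) are theorems there; `rstep` (support form, at the LIVE selector's families) and `contT` (selector-blind) are HYPOTHESES displayed verbatim
as `Provisos₁₀` reads them at `θ₀ˡⁱᵛᵉ`. [cite: Balaban1988Convergent, (2.18) p.257, (3.2)–(3.9) pp.265–266, (3.16) p.268; Balaban1989LargeFieldI, (0.3)–(0.4) p.176 (bookkeeping)] -/
theorem provisos₁₀_theta12LiveOfRecord_of_localBg
    (hrstep : ∀ (p : B12.RunParams) (k : ℕ) [DecidableEq (PBond (F.P p.K) (k + 1))], k < p.K →
      (towerRepOfRecord F N numerics7OfRecord₁₂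
          (theta12LiveOfRecord F N (zeta316OfRecord F N numerics7OfRecord₁₂ 1 1) (RzOfRecord F N) (ZtOfRecord F N)).τ9
          (slotsTOfRecord F N numerics7OfRecord₁₂
            (theta12LiveOfRecord F N (zeta316OfRecord F N numerics7OfRecord₁₂ 1 1) (RzOfRecord F N) (ZtOfRecord F N)).τ9
            (EOfRecord₁₀ F N (theta12LiveOfRecord F N (zeta316OfRecord F N numerics7OfRecord₁₂ 1 1) (RzOfRecord F N) (ZtOfRecord F N)).toStage9Params)
            (wOfRecord₉ F N (theta12LiveOfRecord F N (zeta316OfRecord F N numerics7OfRecord₁₂ 1 1) (RzOfRecord F N) (ZtOfRecord F N)).toStage9Params)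
            (theta12LiveOfRecord F N (zeta316OfRecord F N numerics7OfRecord₁₂ 1 1) (RzOfRecord F N) (ZtOfRecord F N)).ppSel)
          (theta12LiveOfRecord F N (zeta316OfRecord F N numerics7OfRecord₁₂ 1 1) (RzOfRecord F N) (ZtOfRecord F N)).ppSel p
          (gOfRecord₁₀ F N (theta12LiveOfRecord F N (zeta316OfRecord F N numerics7OfRecord₁₂ 1 1) (RzOfRecord F N) (ZtOfRecord F N)).toStage9Params p)
          (k + 1)).toRepData.ProvisosSupp)
    (hcontT : (theta12LiveOfRecord F N (zeta316OfRecord F N numerics7OfRecord₁₂ 1 1) (RzOfRecord F N) (ZtOfRecord F N)).toStage8Params.HasContTransportAlong) :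
    (theta12LiveOfRecord F N (zeta316OfRecord F N numerics7OfRecord₁₂ 1 1) (RzOfRecord F N) (ZtOfRecord F N)).toStage9Params.Provisos₁₀ :=
  (theta12OfRecord F N (zeta316OfRecord F N numerics7OfRecord₁₂ 1 1) (RzOfRecord F N) (ZtOfRecord F N)).provisos₁₀_liveRepin_of_localBg
    hU ⟨rfl, rfl, rfl⟩ hrstep hcontT

/-- **`Provisos₁₂` AT θ₀ˡⁱᵛᵉ OF RECORD, MODULO (H-U), P6, P7, P11**: the previous + K0b's residual laws; `bg` (row P11) a HYPOTHESIS displayed verbatim as `Provisos₁₂` reads it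
at `θ₀ˡⁱᵛᵉ` (`γ = 1∕2`, `τ9.M = 1`, `Rz = RzOfRecord` by `rfl`; the same text as at `θ₀`, `bg_theta12LiveOfRecord_iff`). [cite: Balaban1988Convergent, (2.28) p.259, (2.35) p.261; Balaban1987RG1, (1.15) p.262 (bookkeeping)] -/
theorem provisos₁₂_theta12LiveOfRecord_of_localBg
    (hrstep : ∀ (p : B12.RunParams) (k : ℕ) [DecidableEq (PBond (F.P p.K) (k + 1))], k < p.K →
      (towerRepOfRecord F N numerics7OfRecord₁₂
          (theta12LiveOfRecord F N (zeta316OfRecord F N numerics7OfRecord₁₂ 1 1) (RzOfRecord F N) (ZtOfRecord F N)).τ9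
          (slotsTOfRecord F N numerics7OfRecord₁₂
            (theta12LiveOfRecord F N (zeta316OfRecord F N numerics7OfRecord₁₂ 1 1) (RzOfRecord F N) (ZtOfRecord F N)).τ9
            (EOfRecord₁₀ F N (theta12LiveOfRecord F N (zeta316OfRecord F N numerics7OfRecord₁₂ 1 1) (RzOfRecord F N) (ZtOfRecord F N)).toStage9Params)
            (wOfRecord₉ F N (theta12LiveOfRecord F N (zeta316OfRecord F N numerics7OfRecord₁₂ 1 1) (RzOfRecord F N) (ZtOfRecord F N)).toStage9Params)
            (theta12LiveOfRecord F N (zeta316OfRecord F N numerics7OfRecord₁₂ 1 1) (RzOfRecord F N) (ZtOfRecord F N)).ppSel)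
          (theta12LiveOfRecord F N (zeta316OfRecord F N numerics7OfRecord₁₂ 1 1) (RzOfRecord F N) (ZtOfRecord F N)).ppSel p
          (gOfRecord₁₀ F N (theta12LiveOfRecord F N (zeta316OfRecord F N numerics7OfRecord₁₂ 1 1) (RzOfRecord F N) (ZtOfRecord F N)).toStage9Params p)
          (k + 1)).toRepData.ProvisosSupp)
    (hcontT : (theta12LiveOfRecord F N (zeta316OfRecord F N numerics7OfRecord₁₂ 1 1) (RzOfRecord F N) (ZtOfRecord F N)).toStage8Params.HasContTransportAlong)
    (hbg : ∀ (p : B12.RunParams) (n : ℕ), n ≤ p.K →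
      Step.InInterval (1 / 2 : ℝ) n
        (gOfRecord₁₀ F N (theta12LiveOfRecord F N (zeta316OfRecord F N numerics7OfRecord₁₂ 1 1) (RzOfRecord F N) (ZtOfRecord F N)).toStage9Params p) →
      BgProviso F N p.K
        (settingOfRecord₁₂ F N (theta12LiveOfRecord F N (zeta316OfRecord F N numerics7OfRecord₁₂ 1 1) (RzOfRecord F N) (ZtOfRecord F N)) p)
        (RzOfRecord F N p.K) 1 n
        (suppOfRecord₁₂ F N (theta12LiveOfRecord F N (zeta316OfRecord F N numerics7OfRecord₁₂ 1 1) (RzOfRecord F N) (ZtOfRecord F N)) p n)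
        (UbgOfRecord₁₂ F N (theta12LiveOfRecord F N (zeta316OfRecord F N numerics7OfRecord₁₂ 1 1) (RzOfRecord F N) (ZtOfRecord F N)) p n)) :
    (theta12LiveOfRecord F N (zeta316OfRecord F N numerics7OfRecord₁₂ 1 1) (RzOfRecord F N) (ZtOfRecord F N)).Provisos₁₂ F N :=
  (theta12OfRecord F N (zeta316OfRecord F N numerics7OfRecord₁₂ 1 1) (RzOfRecord F N) (ZtOfRecord F N)).provisos₁₂_liveRepin_of_localBg
    hU ⟨rfl, rfl, rfl⟩ hrstep hcontT hbg

/-- **★★ K0′'s rev-15 BODY FOR THE FAMILY `F` (every `N`) AT θ₀ˡⁱᵛᵉ OF RECORD, FROM EXACTLY FOUR NAMED ROWS**: (H-U) `LocalBgMeasurable F N numerics7OfRecord₁₂`, P6 `rstep`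
(support form, at the live selector's slot families), P7 `contT`, P11 `bg` — all read at `θ₀ˡⁱᵛᵉ`; rows P1 ∕ P2 ∕ P3 ∕ P4 ∕ P5 ∕ (H-ζ) ∕ P12 ∕ `ZtUnity` ∕ `Admissible` ∕ the
residual laws are THEOREMS there (this file, K0b, K0a).  Compare FILE 3's `record12Inhabited_body15_theta12OfRecord_of`, which at the identity selector needed row P12 as a
fifth hypothesis.  A REDUCTION — nothing is discharged. [cite: Balaban1988Convergent, Thm 1 p.262, (3.22) p.269; Balaban1989LargeFieldII, Thm 1 p.355 (bookkeeping)] -/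
theorem record12Inhabited_body15_theta12LiveOfRecord_of
    (hrstep : ∀ (p : B12.RunParams) (k : ℕ) [DecidableEq (PBond (F.P p.K) (k + 1))], k < p.K →
      (towerRepOfRecord F N numerics7OfRecord₁₂
          (theta12LiveOfRecord F N (zeta316OfRecord F N numerics7OfRecord₁₂ 1 1) (RzOfRecord F N) (ZtOfRecord F N)).τ9
          (slotsTOfRecord F N numerics7OfRecord₁₂
            (theta12LiveOfRecord F N (zeta316OfRecord F N numerics7OfRecord₁₂ 1 1) (RzOfRecord F N) (ZtOfRecord F N)).τ9
            (EOfRecord₁₀ F N (theta12LiveOfRecord F N (zeta316OfRecord F N numerics7OfRecord₁₂ 1 1) (RzOfRecord F N) (ZtOfRecord F N)).toStage9Params)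
            (wOfRecord₉ F N (theta12LiveOfRecord F N (zeta316OfRecord F N numerics7OfRecord₁₂ 1 1) (RzOfRecord F N) (ZtOfRecord F N)).toStage9Params)
            (theta12LiveOfRecord F N (zeta316OfRecord F N numerics7OfRecord₁₂ 1 1) (RzOfRecord F N) (ZtOfRecord F N)).ppSel)
          (theta12LiveOfRecord F N (zeta316OfRecord F N numerics7OfRecord₁₂ 1 1) (RzOfRecord F N) (ZtOfRecord F N)).ppSel p
          (gOfRecord₁₀ F N (theta12LiveOfRecord F N (zeta316OfRecord F N numerics7OfRecord₁₂ 1 1) (RzOfRecord F N) (ZtOfRecord F N)).toStage9Params p)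
          (k + 1)).toRepData.ProvisosSupp)
    (hcontT : (theta12LiveOfRecord F N (zeta316OfRecord F N numerics7OfRecord₁₂ 1 1) (RzOfRecord F N) (ZtOfRecord F N)).toStage8Params.HasContTransportAlong)
    (hbg : ∀ (p : B12.RunParams) (n : ℕ), n ≤ p.K →
      Step.InInterval (1 / 2 : ℝ) n
        (gOfRecord₁₀ F N (theta12LiveOfRecord F N (zeta316OfRecord F N numerics7OfRecord₁₂ 1 1) (RzOfRecord F N) (ZtOfRecord F N)).toStage9Params p) →
      BgProviso F N p.K
        (settingOfRecord₁₂ F N (theta12LiveOfRecord F N (zeta316OfRecord F N numerics7OfRecord₁₂ 1 1) (RzOfRecord F N) (ZtOfRecord F N)) p)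
        (RzOfRecord F N p.K) 1 n
        (suppOfRecord₁₂ F N (theta12LiveOfRecord F N (zeta316OfRecord F N numerics7OfRecord₁₂ 1 1) (RzOfRecord F N) (ZtOfRecord F N)) p n)
        (UbgOfRecord₁₂ F N (theta12LiveOfRecord F N (zeta316OfRecord F N numerics7OfRecord₁₂ 1 1) (RzOfRecord F N) (ZtOfRecord F N)) p n)) :
    ∃ θ : Stage12Params F N, θ.Provisos₁₂ F N ∧ (θ.ZtUnity F N ∧ θ.SlotsNondegenerate) ∧ θ.Admissible F N :=
  (theta12OfRecord F N (zeta316OfRecord F N numerics7OfRecord₁₂ 1 1) (RzOfRecord F N) (ZtOfRecord F N)).record12Inhabited_body15_liveRepin_of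
    hU ⟨rfl, rfl, rfl⟩ hrstep hcontT hbg (admissible_theta12OfRecord F N _ _ _)

omit hU in
/-- **Row P11 at θ₀ˡⁱᵛᵉ IS row P11 at θ₀** (the run objects read no selector): FILE 3's `hbg` text serves verbatim. [cite: Balaban1988Convergent, (2.28) p.259, (2.35) p.261 (bookkeeping)] -/
theorem bg_theta12LiveOfRecord_iff :
    (∀ (p : B12.RunParams) (n : ℕ), n ≤ p.K →
      Step.InInterval (1 / 2 : ℝ) n
        (gOfRecord₁₀ F N (theta12LiveOfRecord F N (zeta316OfRecord F N numerics7OfRecord₁₂ 1 1) (RzOfRecord F N) (ZtOfRecord F N)).toStage9Params p) →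
      BgProviso F N p.K
        (settingOfRecord₁₂ F N (theta12LiveOfRecord F N (zeta316OfRecord F N numerics7OfRecord₁₂ 1 1) (RzOfRecord F N) (ZtOfRecord F N)) p)
        (RzOfRecord F N p.K) 1 n
        (suppOfRecord₁₂ F N (theta12LiveOfRecord F N (zeta316OfRecord F N numerics7OfRecord₁₂ 1 1) (RzOfRecord F N) (ZtOfRecord F N)) p n)
        (UbgOfRecord₁₂ F N (theta12LiveOfRecord F N (zeta316OfRecord F N numerics7OfRecord₁₂ 1 1) (RzOfRecord F N) (ZtOfRecord F N)) p n)) ↔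
    (∀ (p : B12.RunParams) (n : ℕ), n ≤ p.K →
      Step.InInterval (1 / 2 : ℝ) n
        (gOfRecord₁₀ F N (theta12OfRecord F N (zeta316OfRecord F N numerics7OfRecord₁₂ 1 1) (RzOfRecord F N) (ZtOfRecord F N)).toStage9Params p) →
      BgProviso F N p.K
        (settingOfRecord₁₂ F N (theta12OfRecord F N (zeta316OfRecord F N numerics7OfRecord₁₂ 1 1) (RzOfRecord F N) (ZtOfRecord F N)) p)
        (RzOfRecord F N p.K) 1 n
        (suppOfRecord₁₂ F N (theta12OfRecord F N (zeta316OfRecord F N numerics7OfRecord₁₂ 1 1) (RzOfRecord F N) (ZtOfRecord F N)) p n)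
        (UbgOfRecord₁₂ F N (theta12OfRecord F N (zeta316OfRecord F N numerics7OfRecord₁₂ 1 1) (RzOfRecord F N) (ZtOfRecord F N)) p n)) :=
  (theta12OfRecord F N (zeta316OfRecord F N numerics7OfRecord₁₂ 1 1) (RzOfRecord F N) (ZtOfRecord F N)).bg_liveRepin_iff

end AtLiveRecord

/-! ## §4. The text of `Record12Inhabited` (stmt-QuantumFields-19902, rev 15) FOR ONE FAMILY `F`, `N = 2`, from the four named rows at θ₀ˡⁱᵛᵉ -/

section K0Prime

/-- **★★ K0′'s TEXT FOR THE FAMILY `F` AT `N = 2` FROM EXACTLY (H-U) ∧ P6 ∧ P7 ∧ P11 READ AT θ₀ˡⁱᵛᵉ OF RECORD** — `∃ θ : Stage12Params F 2, θ.Provisos₁₂ F 2 ∧ (θ.ZtUnity F 2 ∧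
θ.SlotsNondegenerate) ∧ θ.Admissible F 2`, the body of `Record12Inhabited` for `F` verbatim (no `Theses` import; director-ym №116).  With K0a's
`exists_k0prime_of_theta12Live_of_provisos₁₂` (K0′(F) ⟸ `Provisos₁₂ θ₀ˡⁱᵛᵉ`) this is the row-by-row split of that one hypothesis.  The four rows are DISPLAYED, not asserted;
K0′ is NOT discharged. [cite: Balaban1988Convergent, Thm 1 p.262, (3.16)–(3.22) pp.268–269; Balaban1989LargeFieldI, (0.3)–(0.4) p.176 (bookkeeping)] -/
theorem exists_k0prime_of_localBg_theta12Live (F : T4Family) (hU : LocalBgMeasurable F 2 numerics7OfRecord₁₂)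
    (hrstep : ∀ (p : B12.RunParams) (k : ℕ) [DecidableEq (PBond (F.P p.K) (k + 1))], k < p.K →
      (towerRepOfRecord F 2 numerics7OfRecord₁₂
          (theta12LiveOfRecord F 2 (zeta316OfRecord F 2 numerics7OfRecord₁₂ 1 1) (RzOfRecord F 2) (ZtOfRecord F 2)).τ9
          (slotsTOfRecord F 2 numerics7OfRecord₁₂
            (theta12LiveOfRecord F 2 (zeta316OfRecord F 2 numerics7OfRecord₁₂ 1 1) (RzOfRecord F 2) (ZtOfRecord F 2)).τ9
            (EOfRecord₁₀ F 2 (theta12LiveOfRecord F 2 (zeta316OfRecord F 2 numerics7OfRecord₁₂ 1 1) (RzOfRecord F 2) (ZtOfRecord F 2)).toStage9Params)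
            (wOfRecord₉ F 2 (theta12LiveOfRecord F 2 (zeta316OfRecord F 2 numerics7OfRecord₁₂ 1 1) (RzOfRecord F 2) (ZtOfRecord F 2)).toStage9Params)
            (theta12LiveOfRecord F 2 (zeta316OfRecord F 2 numerics7OfRecord₁₂ 1 1) (RzOfRecord F 2) (ZtOfRecord F 2)).ppSel)
          (theta12LiveOfRecord F 2 (zeta316OfRecord F 2 numerics7OfRecord₁₂ 1 1) (RzOfRecord F 2) (ZtOfRecord F 2)).ppSel p
          (gOfRecord₁₀ F 2 (theta12LiveOfRecord F 2 (zeta316OfRecord F 2 numerics7OfRecord₁₂ 1 1) (RzOfRecord F 2) (ZtOfRecord F 2)).toStage9Params p)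
          (k + 1)).toRepData.ProvisosSupp)
    (hcontT : (theta12LiveOfRecord F 2 (zeta316OfRecord F 2 numerics7OfRecord₁₂ 1 1) (RzOfRecord F 2) (ZtOfRecord F 2)).toStage8Params.HasContTransportAlong)
    (hbg : ∀ (p : B12.RunParams) (n : ℕ), n ≤ p.K →
      Step.InInterval (1 / 2 : ℝ) n
        (gOfRecord₁₀ F 2 (theta12LiveOfRecord F 2 (zeta316OfRecord F 2 numerics7OfRecord₁₂ 1 1) (RzOfRecord F 2) (ZtOfRecord F 2)).toStage9Params p) →
      BgProviso F 2 p.K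
        (settingOfRecord₁₂ F 2 (theta12LiveOfRecord F 2 (zeta316OfRecord F 2 numerics7OfRecord₁₂ 1 1) (RzOfRecord F 2) (ZtOfRecord F 2)) p)
        (RzOfRecord F 2 p.K) 1 n
        (suppOfRecord₁₂ F 2 (theta12LiveOfRecord F 2 (zeta316OfRecord F 2 numerics7OfRecord₁₂ 1 1) (RzOfRecord F 2) (ZtOfRecord F 2)) p n)
        (UbgOfRecord₁₂ F 2 (theta12LiveOfRecord F 2 (zeta316OfRecord F 2 numerics7OfRecord₁₂ 1 1) (RzOfRecord F 2) (ZtOfRecord F 2)) p n)) :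
    ∃ θ : Stage12Params F 2, θ.Provisos₁₂ F 2 ∧ (θ.ZtUnity F 2 ∧ θ.SlotsNondegenerate) ∧ θ.Admissible F 2 :=
  record12Inhabited_body15_theta12LiveOfRecord_of hU hrstep hcontT hbg

/-- **RUNG B AT θ₀ˡⁱᵛᵉ OF RECORD MODULO ROW P11 ONLY** (the shape of plan g65's skeleton v4-LIVE stub `stub_resid12Live : Provisos₁₀ → Provisos₁₂` at the live
witness): GIVEN `base = Provisos₁₀` of the re-pinned tuple (rung A) and the `bg` row P11 displayed verbatim, `Provisos₁₂` at `θ₀ˡⁱᵛᵉ` follows — `rzLaws`, `ztLaws`,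
`ztLocal` are K0b's theorems at the residuals of record (`HasResidualsOfRecord`, K0a's `hasResidualsOfRecord_theta12LiveOfRecord`).  Every `N`.
[cite: Balaban1988Convergent, (2.21) p.258, (2.28) p.259, (2.35) p.261, (3.20) p.269; Balaban1987RG1, (1.15) p.262 (bookkeeping)] -/
theorem provisos₁₂_theta12LiveOfRecord_of_base
    (hbase : (theta12LiveOfRecord F N (zeta316OfRecord F N numerics7OfRecord₁₂ 1 1) (RzOfRecord F N) (ZtOfRecord F N)).toStage9Params.Provisos₁₀)
    (hbg : ∀ (p : B12.RunParams) (n : ℕ), n ≤ p.K →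
      Step.InInterval (1 / 2 : ℝ) n
        (gOfRecord₁₀ F N (theta12LiveOfRecord F N (zeta316OfRecord F N numerics7OfRecord₁₂ 1 1) (RzOfRecord F N) (ZtOfRecord F N)).toStage9Params p) →
      BgProviso F N p.K
        (settingOfRecord₁₂ F N (theta12LiveOfRecord F N (zeta316OfRecord F N numerics7OfRecord₁₂ 1 1) (RzOfRecord F N) (ZtOfRecord F N)) p)
        (RzOfRecord F N p.K) 1 n
        (suppOfRecord₁₂ F N (theta12LiveOfRecord F N (zeta316OfRecord F N numerics7OfRecord₁₂ 1 1) (RzOfRecord F N) (ZtOfRecord F N)) p n)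
        (UbgOfRecord₁₂ F N (theta12LiveOfRecord F N (zeta316OfRecord F N numerics7OfRecord₁₂ 1 1) (RzOfRecord F N) (ZtOfRecord F N)) p n)) :
    (theta12LiveOfRecord F N (zeta316OfRecord F N numerics7OfRecord₁₂ 1 1) (RzOfRecord F N) (ZtOfRecord F N)).Provisos₁₂ F N :=
  ⟨hbase, (hasResidualsOfRecord_theta12LiveOfRecord F N).rzLaws, (hasResidualsOfRecord_theta12LiveOfRecord F N).ztLaws,
    (hasResidualsOfRecord_theta12LiveOfRecord F N).ztLocal, hbg⟩

/-- **… hence K0′'s TEXT FOR `F` AT `N = 2` FROM RUNG A (`Provisos₁₀` at θ₀ˡⁱᵛᵉ) AND ROW P11 ALONE** (K0a's `exists_k0prime_of_theta12Live_of_provisos₁₂` ∘ the previous).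
The two hypotheses are DISPLAYED, not asserted; K0′ is NOT discharged. [cite: Balaban1988Convergent, Thm 1 p.262, (3.16)–(3.22) pp.268–269 (bookkeeping)] -/
theorem exists_k0prime_of_base_of_bg_theta12Live (F : T4Family)
    (hbase : (theta12LiveOfRecord F 2 (zeta316OfRecord F 2 numerics7OfRecord₁₂ 1 1) (RzOfRecord F 2) (ZtOfRecord F 2)).toStage9Params.Provisos₁₀)
    (hbg : ∀ (p : B12.RunParams) (n : ℕ), n ≤ p.K →
      Step.InInterval (1 / 2 : ℝ) n
        (gOfRecord₁₀ F 2 (theta12LiveOfRecord F 2 (zeta316OfRecord F 2 numerics7OfRecord₁₂ 1 1) (RzOfRecord F 2) (ZtOfRecord F 2)).toStage9Params p) →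
      BgProviso F 2 p.K
        (settingOfRecord₁₂ F 2 (theta12LiveOfRecord F 2 (zeta316OfRecord F 2 numerics7OfRecord₁₂ 1 1) (RzOfRecord F 2) (ZtOfRecord F 2)) p)
        (RzOfRecord F 2 p.K) 1 n
        (suppOfRecord₁₂ F 2 (theta12LiveOfRecord F 2 (zeta316OfRecord F 2 numerics7OfRecord₁₂ 1 1) (RzOfRecord F 2) (ZtOfRecord F 2)) p n)
        (UbgOfRecord₁₂ F 2 (theta12LiveOfRecord F 2 (zeta316OfRecord F 2 numerics7OfRecord₁₂ 1 1) (RzOfRecord F 2) (ZtOfRecord F 2)) p n)) :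
    ∃ θ : Stage12Params F 2, θ.Provisos₁₂ F 2 ∧ (θ.ZtUnity F 2 ∧ θ.SlotsNondegenerate) ∧ θ.Admissible F 2 :=
  exists_k0prime_of_theta12Live_of_provisos₁₂ F (provisos₁₂_theta12LiveOfRecord_of_base F 2 hbase hbg)

end K0Prime

end Literature.MathematicalPhysics.QuantumFieldTheory.Balaban1983to89.Node00

end
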